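import Mathlib
import Literature.Probability.LatticeModels.SharpnessProofs
import HarnessLib

/-!
# Stub `stub_fluxPositivity` of line `diffusive-branch-is-nonsaturation` (crux
# `PrecisionLaplacian.DirectCorrelationStableTail`, stmt-CriticalPhenomena-4799): flux identity with
# autocorrelation weights and positivity of the shifted-box quadratic form (Ising-free)

**Statement** (registered text, = `stub_fluxPositivity` of the lead's skeleton).  Let `a ∈ ℓ¹(ℤ³)`
with `Σ a = 0`, `a ≥ 0` off `0`, let `G : ℤ³ → ℝ` be even with `|G| ≤ 1`, `Σ_y a(y) G(z − y) = −δ_{z0}`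
(the precision row identity) and all finite quadratic forms `Σ_{x,x'∈A} c(x)c(x')G(x'−x) ≥ 0`.  With
`B = box 3 R = {−R,…,R}³` and the autocorrelation-weighted box functional
`D(y) := Σ_{b,b'∈B} (G(b'−b) − G(b'−b−y))`:
1. every finite partial sum satisfies `Σ_{y∈Y} a(y) D(y) ≤ (2R+1)³`;
2. `D(y) = ½ Σ_{x,x'∈S} v(x) v(x') G(x'−x)` for `S = B ∪ (B + y)` and the shifted-box vector
   `v(x) = [x ∈ B] − [x − y ∈ B]`.

**Proof.**
* (2) is finite algebra: on `S`, `Σ_{x∈S} [x∈B] F(x) = Σ_{b∈B} F(b)` and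
  `Σ_{x∈S} [x−y∈B] F(x) = Σ_{b∈B} F(b+y)`; expanding the four terms, the two diagonal ones are both
  `Ψ₀ = Σ_{b,b'} G(b'−b)` (translation invariance) and the two cross terms are both
  `Ψ(y) = Σ_{b,b'} G(b'−b−y)` (swap `b ↔ b'` and use evenness of `G`), so `⟨v,Gv⟩ = 2(Ψ₀ − Ψ(y)) = 2D(y)`.
* (1): by (2) and positive definiteness `D(y) ≥ 0`; `D(0) = 0`; so `a(y)D(y) ≥ 0` termwise.  The flux
  identity `Σ'_y a(y) D(y) = (2R+1)³`: `Σ'_y a(y)Ψ₀ = Ψ₀ Σ' a = 0`, and exchanging the finite box sums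
  with the `a`-series, `Σ'_y a(y)Ψ(y) = Σ_{b,b'∈B} Σ'_y a(y) G((b'−b)−y) = Σ_{b,b'∈B} (−δ_{b'b}) = −(2R+1)³`.
  Hence `Σ_{y∈Y} a(y)D(y) ≤ Σ'_y a(y)D(y) = (2R+1)³` (`Summable.sum_le_tsum`).

Pure theorem file, no definitions, no `sorry`.  Folklore (discrete Green-function flux bookkeeping);
cf. G. Lawler, V. Limic, *Random Walk: A Modern Introduction* (2010), §4.6, §6.2.
-/

noncomputable section

namespace Summit.CriticalPhenomena.Ising3DConformalLimit.Cruxes.DirectCorrelationStableTail.DiffusiveBranchIsNonsaturation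

open Filter Topology
open scoped BigOperators
open Literature.Probability.LatticeModels

/-! ### Finite algebra on the shifted box `S = B ∪ (B + y)` -/

/-- Membership in the translate `B + y`: `x ∈ B.image (· + y) ↔ x − y ∈ B`. [folklore] -/
theorem fluxPos_mem_image_add_iff (B : Finset (Site 3)) (y x : Site 3) :
    x ∈ B.image (· + y) ↔ x - y ∈ B := by
  constructor
  · intro hx
    obtain ⟨b, hb, rfl⟩ := Finset.mem_image.1 hx
    simpa using hb
  · intro h
    exact Finset.mem_image.2 ⟨x - y, h, sub_add_cancel x y⟩

/-- `Σ_{x ∈ B ∪ (B+y)} [x ∈ B] F(x) = Σ_{b ∈ B} F(b)`. [folklore] -/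
theorem fluxPos_sum_indicator_mul (B : Finset (Site 3)) (y : Site 3) (F : Site 3 → ℝ) :
    ∑ x ∈ B ∪ B.image (· + y), (if x ∈ B then (1 : ℝ) else 0) * F x = ∑ b ∈ B, F b := by
  have h : ∀ x, (if x ∈ B then (1 : ℝ) else 0) * F x = if x ∈ B then F x else 0 := fun x => by
    split_ifs <;> simp
  simp_rw [h]
  rw [Finset.sum_ite_mem, Finset.union_inter_cancel_left]

/-- `Σ_{x ∈ B ∪ (B+y)} [x − y ∈ B] F(x) = Σ_{b ∈ B} F(b + y)`. [folklore] -/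
theorem fluxPos_sum_shiftIndicator_mul (B : Finset (Site 3)) (y : Site 3) (F : Site 3 → ℝ) :
    ∑ x ∈ B ∪ B.image (· + y), (if x - y ∈ B then (1 : ℝ) else 0) * F x =
      ∑ b ∈ B, F (b + y) := by
  have h : ∀ x, (if x - y ∈ B then (1 : ℝ) else 0) * F x =
      if x ∈ B.image (· + y) then F x else 0 := by
    intro x
    simp only [fluxPos_mem_image_add_iff]
    split_ifs <;> simp
  simp_rw [h]
  rw [Finset.sum_ite_mem, Finset.union_inter_cancel_right, Finset.sum_image]
  exact fun b _ b' _ hbb' => add_left_injective y hbb'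

/-- Pairing with the shifted-box vector `v = 𝟙_B − 𝟙_{B+y}` on `S = B ∪ (B+y)`:
`Σ_{x∈S} v(x) F(x) = Σ_{b∈B} F(b) − Σ_{b∈B} F(b+y)`. [folklore] -/
theorem fluxPos_sum_v_mul (B : Finset (Site 3)) (y : Site 3) (F : Site 3 → ℝ) :
    ∑ x ∈ B ∪ B.image (· + y),
        ((if x ∈ B then (1 : ℝ) else 0) - (if x - y ∈ B then (1 : ℝ) else 0)) * F x =
      ∑ b ∈ B, F b - ∑ b ∈ B, F (b + y) := by
  simp_rw [sub_mul]
  rw [Finset.sum_sub_distrib, fluxPos_sum_indicator_mul, fluxPos_sum_shiftIndicator_mul]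

/-- The cross term: `Σ_{b,b'∈B} G(b'+y−b) = Σ_{b,b'∈B} G(b'−b−y)` for even `G` (swap `b ↔ b'`).
[folklore] -/
theorem fluxPos_cross (B : Finset (Site 3)) (G : Site 3 → ℝ) (hG : ∀ w, G (-w) = G w)
    (y : Site 3) :
    ∑ b ∈ B, ∑ b' ∈ B, G (b' + y - b) = ∑ b ∈ B, ∑ b' ∈ B, G (b' - b - y) := by
  rw [Finset.sum_comm]
  refine Finset.sum_congr rfl fun b _ => Finset.sum_congr rfl fun b' _ => ?_
  rw [← hG (b' - b - y)]
  congr 1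
  abel

/-- **The shifted-box quadratic form.**  For even `G`,
`Σ_{b,b'∈B} (G(b'−b) − G(b'−b−y)) = ½ Σ_{x,x'∈S} v(x) v(x') G(x'−x)` with `S = B ∪ (B+y)`,
`v(x) = [x∈B] − [x−y∈B]`. [folklore] -/
theorem fluxPos_quadForm (B : Finset (Site 3)) (G : Site 3 → ℝ) (hG : ∀ w, G (-w) = G w)
    (y : Site 3) :
    ∑ b ∈ B, ∑ b' ∈ B, (G (b' - b) - G (b' - b - y)) =
      (1 / 2) * ∑ x ∈ B ∪ B.image (· + y), ∑ x' ∈ B ∪ B.image (· + y),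
        ((if x ∈ B then (1 : ℝ) else 0) - (if x - y ∈ B then (1 : ℝ) else 0)) *
          ((if x' ∈ B then (1 : ℝ) else 0) - (if x' - y ∈ B then (1 : ℝ) else 0)) * G (x' - x) := by
  have hinner : ∀ x, ∑ x' ∈ B ∪ B.image (· + y),
      ((if x ∈ B then (1 : ℝ) else 0) - (if x - y ∈ B then (1 : ℝ) else 0)) *
        ((if x' ∈ B then (1 : ℝ) else 0) - (if x' - y ∈ B then (1 : ℝ) else 0)) * G (x' - x) =
      ((if x ∈ B then (1 : ℝ) else 0) - (if x - y ∈ B then (1 : ℝ) else 0)) *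
        (∑ b' ∈ B, G (b' - x) - ∑ b' ∈ B, G (b' + y - x)) := by
    intro x
    rw [← fluxPos_sum_v_mul B y (fun x' => G (x' - x)), Finset.mul_sum]
    refine Finset.sum_congr rfl fun x' _ => ?_
    ring
  rw [Finset.sum_congr rfl fun x _ => hinner x,
    fluxPos_sum_v_mul B y (fun x => ∑ b' ∈ B, G (b' - x) - ∑ b' ∈ B, G (b' + y - x))]
  have h3 : ∑ b ∈ B, ∑ b' ∈ B, G (b' - (b + y)) = ∑ b ∈ B, ∑ b' ∈ B, G (b' - b - y) :=
    Finset.sum_congr rfl fun b _ => Finset.sum_congr rfl fun b' _ => by rw [sub_add_eq_sub_sub]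
  have h4 : ∑ b ∈ B, ∑ b' ∈ B, G (b' + y - (b + y)) = ∑ b ∈ B, ∑ b' ∈ B, G (b' - b) :=
    Finset.sum_congr rfl fun b _ => Finset.sum_congr rfl fun b' _ => by rw [add_sub_add_right_eq_sub]
  simp only [Finset.sum_sub_distrib]
  rw [fluxPos_cross B G hG y, h3, h4]
  ring

/-! ### The registered stub -/

/-- **Stub `stub_fluxPositivity` (flux identity with autocorrelation weights + positivity;
Ising-free).**  For `a ∈ ℓ¹`, `Σ a = 0`, `a ≥ 0` off `0`, `|G| ≤ 1` even with `a ∗ G = −δ₀` and all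
finite quadratic forms of `G` nonnegative: with `D(y) := Σ_{b,b'∈Λ_R} (G(b'−b) − G(b'−b−y))` one has
`Σ'_y a(y) D(y) = (2R+1)³` (sum the convolution identity over `(b,b') ∈ Λ_R²` at `z = b'−b`;
`Σ a = 0` removes `Σ_y a(y)·Σ G(b'−b)`), `D(y) = ½⟨v, G v⟩ ≥ 0` for the shifted-box vector
`v = 𝟙_{Λ_R} − 𝟙_{Λ_R+y}` (evenness pairs the two cross terms), so every finite partial sum is
`≤ (2R+1)³`. [folklore] -/
theorem stub_fluxPositivity :
    ∀ (a G : Site 3 → ℝ) (R : ℕ) (Y : Finset (Site 3)), Summable a → (∑' y, a y) = 0 →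
      (∀ y, y ≠ 0 → 0 ≤ a y) → (∀ w, |G w| ≤ 1) → (∀ w, G (-w) = G w) →
      (∀ z : Site 3, (∑' y, a y * G (z - y)) = if z = 0 then -1 else 0) →
      (∀ (A : Finset (Site 3)) (c : Site 3 → ℝ), 0 ≤ ∑ x ∈ A, ∑ x' ∈ A, c x * c x' * G (x' - x)) →
      (∑ y ∈ Y, a y * ∑ b ∈ box 3 R, ∑ b' ∈ box 3 R, (G (b' - b) - G (b' - b - y)) ≤
        (2 * (R : ℝ) + 1) ^ 3) ∧
      (∀ y : Site 3, ∑ b ∈ box 3 R, ∑ b' ∈ box 3 R, (G (b' - b) - G (b' - b - y)) =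
        (1 / 2) * ∑ x ∈ (box 3 R ∪ (box 3 R).image (· + y)),
          ∑ x' ∈ (box 3 R ∪ (box 3 R).image (· + y)),
            ((if x ∈ box 3 R then (1 : ℝ) else 0) - (if x - y ∈ box 3 R then (1 : ℝ) else 0)) *
              ((if x' ∈ box 3 R then (1 : ℝ) else 0) - (if x' - y ∈ box 3 R then (1 : ℝ) else 0)) *
                G (x' - x)) := by
  intro a G R Y ha hzero hnn hG1 hGe hconv hpd
  have h2 := fluxPos_quadForm (box 3 R) G hGe
  refine ⟨?_, h2⟩
  -- (α) nonnegativity of `D(y)` from positive definiteness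
  have hD : ∀ y, 0 ≤ ∑ b ∈ box 3 R, ∑ b' ∈ box 3 R, (G (b' - b) - G (b' - b - y)) := by
    intro y
    rw [h2 y]
    exact mul_nonneg (by norm_num) (hpd (box 3 R ∪ (box 3 R).image (· + y))
      (fun x => (if x ∈ box 3 R then (1 : ℝ) else 0) - (if x - y ∈ box 3 R then (1 : ℝ) else 0)))
  -- (β) summability and the flux identity
  have hsG : ∀ z : Site 3, Summable fun y => a y * G (z - y) := fun z => by
    refine Summable.of_norm_bounded ha.norm fun y => ?_
    rw [norm_mul]
    refine mul_le_of_le_one_right (norm_nonneg _) ?_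
    rw [Real.norm_eq_abs]
    exact hG1 (z - y)
  have hpt : ∀ y, a y * ∑ b ∈ box 3 R, ∑ b' ∈ box 3 R, (G (b' - b) - G (b' - b - y)) =
      a y * ∑ b ∈ box 3 R, ∑ b' ∈ box 3 R, G (b' - b) -
        ∑ b ∈ box 3 R, ∑ b' ∈ box 3 R, a y * G (b' - b - y) := by
    intro y
    simp only [Finset.sum_sub_distrib, mul_sub, Finset.mul_sum]
  have hs1 : Summable fun y => a y * ∑ b ∈ box 3 R, ∑ b' ∈ box 3 R, G (b' - b) := ha.mul_right _
  have hs2 : Summable fun y => ∑ b ∈ box 3 R, ∑ b' ∈ box 3 R, a y * G (b' - b - y) :=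
    summable_sum fun b _ => summable_sum fun b' _ => hsG (b' - b)
  have hs : Summable fun y => a y * ∑ b ∈ box 3 R, ∑ b' ∈ box 3 R, (G (b' - b) - G (b' - b - y)) := by
    simp_rw [hpt]
    exact hs1.sub hs2
  have hx : ∑' y, ∑ b ∈ box 3 R, ∑ b' ∈ box 3 R, a y * G (b' - b - y) =
      ∑ b ∈ box 3 R, ∑ b' ∈ box 3 R, ∑' y, a y * G (b' - b - y) := by
    rw [Summable.tsum_finsetSum (fun b _ => summable_sum fun b' _ => hsG (b' - b))]
    exact Finset.sum_congr rfl fun b _ => Summable.tsum_finsetSum fun b' _ => hsG (b' - b)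
  have hdiag : ∑ b ∈ box 3 R, ∑ b' ∈ box 3 R, (∑' y, a y * G (b' - b - y)) = -(2 * (R : ℝ) + 1) ^ 3 := by
    simp_rw [hconv, sub_eq_zero, Finset.sum_ite_eq']
    rw [Finset.sum_congr rfl fun b hb => if_pos hb, Finset.sum_const, card_box, nsmul_eq_mul]
    push_cast
    ring
  have hval : ∑' y, a y * ∑ b ∈ box 3 R, ∑ b' ∈ box 3 R, (G (b' - b) - G (b' - b - y)) =
      (2 * (R : ℝ) + 1) ^ 3 := by
    simp_rw [hpt]
    rw [hs1.tsum_sub hs2, tsum_mul_right, hzero, zero_mul, zero_sub, hx, hdiag, neg_neg]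
  -- (γ) termwise nonnegativity
  have h0 : ∀ y, 0 ≤ a y * ∑ b ∈ box 3 R, ∑ b' ∈ box 3 R, (G (b' - b) - G (b' - b - y)) := by
    intro y
    by_cases hy : y = 0
    · subst hy
      simp
    · exact mul_nonneg (hnn y hy) (hD y)
  -- (δ) partial sums of a nonnegative series
  calc ∑ y ∈ Y, a y * ∑ b ∈ box 3 R, ∑ b' ∈ box 3 R, (G (b' - b) - G (b' - b - y))
      ≤ ∑' y, a y * ∑ b ∈ box 3 R, ∑ b' ∈ box 3 R, (G (b' - b) - G (b' - b - y)) :=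
        hs.sum_le_tsum Y fun y _ => h0 y
    _ = (2 * (R : ℝ) + 1) ^ 3 := hval

end Summit.CriticalPhenomena.Ising3DConformalLimit.Cruxes.DirectCorrelationStableTail.DiffusiveBranchIsNonsaturation

end
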